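/-
Copyright (c) 2026 the pub-hodgecm-mathlib formalisation cell (harness21).  Prover seat hodgecm-mathlib-K2Liu-p10 (g4), Track B «K2-LIT»,
#184♮ = hLiu418 = `stmt-HodgeConjecture-24832`; (σ) endgame organ, SMALL SIDE, S-2a: the Kudla–Rallis functional under Levi and unipotent operators.  KERNEL: theorems only.
-/
import Summits.HodgeConjecture.HodgeConjecture.Theorems.K2LiuKudlaRallisMapDefs          -- ★ β-2 (`krPoint`, `krFun`, `krMap`)
import Literature.MeasureTheory.Group.LocalFieldLinearJacobian                            -- ★ `|det|_v` Jacobian over local fields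
import Literature.RepresentationTheory.HeisenbergGroup.SchrodingerSymplecticGenerators   -- ★ `leviEquivSB`, `leviOp`
import Mathlib.MeasureTheory.Integral.Bochner.Basic
import HarnessLib

/-!
# Crux `HLiu418`, (σ) small side, S-2a: THE KUDLA–RALLIS FUNCTIONAL `Λ(Ψ) = (rΨ)(0) = ∫_{F^α} Ψ(θ⁻¹((0 ⊔ 0) ⊔ t)) dμ(t)` IS A LEVI ∕ UNIPOTENT EIGEN-FUNCTIONAL
# `Λ(Ψ ∘ A⁻¹) = mod_F(det D)⁻¹ · Λ(Ψ)` when `A` acts on the integrated block by `D`;  `Λ(e·Ψ) = Λ(Ψ)` when the phase `e ≡ 1` on the slice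

Cell `hodgecm-mathlib`, crux item hLiu418 = `stmt-HodgeConjecture-24832`, route of record `HCCMUnconditional`; squad K2 ∕ K2Liu, prover K2Liu-p10 (g4).
THEOREMS ONLY; lane `--supports stmt-HodgeConjecture-24832 --as helper`.  Generic: a second-countable locally compact Borel topological field `F` (at the instance `F_v`),
a frame `θ : X ≃ₜ ((β ⊕ γ) ⊕ α → F)`, an additive Haar measure `μ` on `F^α`.

The small-side section of V8e's face (2) in the DIRECT form (my census 13:57Z option (d)): `B Φ h := Λ(ω(h)Φ)` with `Λ Ψ := (krMap θ μ Ψ) 0`.  Its Siegel law is a statement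
about `Λ` alone:
* §1 **`integral_comp_mulVec_eq_smul`**: `∫ f(D t) dμ(t) = mod_F(det D)⁻¹ · ∫ f dμ` (★ `map_eq_addEquivAddHaarChar_inv_smul` + ★ `addEquivAddHaarChar_continuousLinearEquiv`);
* §2 **`krFun_zero_leviOp`**: if `θ(A⁻¹(θ⁻¹((0 ⊔ 0) ⊔ t))) = (0 ⊔ 0) ⊔ (D t)` for all `t` (the slice letter `hS` of ★ (L2-c) at `u = 0`), then
  `Λ(leviOp A Ψ) = mod_F(det D)⁻¹ · Λ(Ψ)`; **`krFun_zero_of_phase_one`**: `Λ(x ↦ e(x)Ψ(x)) = Λ(Ψ)` if `e = 1` on the slice;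
* §3 **`krMap_zero_levi`**: for a Levi law `ω(m a) Φ = c_M(a) • leviEquivSB (aX a) Φ` (★ I-3a ∕ V8e `hM`) with slice matrices `D a`,
  `Λ(ω(m a) Φ) = c_M(a) · mod_F(det (D a))⁻¹ · Λ(Φ)` — with ★ (L3-a) `c_M = localSiegelCharacter χv (½) ∘ m` and the instance Jacobian letter `mod_F(det D a) = |det_Δ m a|_v` this is
  the Siegel law of `B` with character `localSiegelCharacter χv (−½)` (exponent `½ + n/2 − 1`), i.e. V8e's `hSiegS` on `M_Δ`.

HONEST LABEL: HC_CM is proved only modulo the 7 printed citations (2 remaining named inputs: hLiu418 = stmt-HodgeConjecture-24832, h413 = stmt-HodgeConjecture-24833)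
until rung 0 closes; helper, closes no item.
References: [KudlaRallis1994] S. Kudla, S. Rallis, Ann. of Math. 140 (1994) §1; [WeilBNT1967] Ch. I §2 (module of an automorphism); [HarrisKudlaSweet1996] §4.
-/

set_option autoImplicit false
set_option linter.dupNamespace false -- the mandated namespace repeats `HodgeConjecture.HodgeConjecture`

noncomputable section

open MeasureTheory
open scoped ENNReal NNReal Matrix
open Literature.MeasureTheory.Group
open Literature.NumberTheory.Automorphic
open Literature.RepresentationTheory.HeisenbergGroup
open Summit.HodgeConjecture.HodgeConjecture.Cruxes.HLiu418.K2LiuKudlaRallisMapDefs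

namespace Summit.HodgeConjecture.HodgeConjecture.Cruxes.HLiu418.K2LiuKRFunctionalLevi

variable {F : Type*} [Field F] [TopologicalSpace F] [IsTopologicalRing F] [LocallyCompactSpace F]
  [SecondCountableTopology F] [MeasurableSpace F] [BorelSpace F]
  {α : Type*} [Fintype α] [DecidableEq α]

/-! ## §1 Linear change of variables in an integral over `F^α` -/

omit [LocallyCompactSpace F] [SecondCountableTopology F] [MeasurableSpace F] [BorelSpace F] in
/-- the continuous linear automorphism `t ↦ D t` of `F^α` for `det D ≠ 0`. [cite: WeilBNT1967, Ch. I §2] -/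
theorem exists_continuousLinearEquiv_apply_eq_mulVec (D : Matrix α α F) (hD : D.det ≠ 0) :
    ∃ L : (α → F) ≃L[F] (α → F), (∀ t, L t = D *ᵥ t) ∧ LinearEquiv.det L.toLinearEquiv = Units.mk0 D.det hD := by
  let L₀ : (α → F) ≃ₗ[F] (α → F) := Matrix.toLinearEquiv' D (Matrix.invertibleOfIsUnitDet D (isUnit_iff_ne_zero.2 hD))
  let L : (α → F) ≃L[F] (α → F) :=
    { L₀ with continuous_toFun := L₀.toLinearMap.continuous_on_pi, continuous_invFun := L₀.symm.toLinearMap.continuous_on_pi }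
  have hL : ∀ t, L t = D *ᵥ t := fun t => rfl
  refine ⟨L, hL, Units.ext ?_⟩
  rw [LinearEquiv.coe_det, Units.val_mk0]
  have h : (L.toLinearEquiv : (α → F) →ₗ[F] (α → F)) = Matrix.toLin' D := by
    apply LinearMap.ext; intro t; exact hL t
  rw [h, LinearMap.det_toLin']

/-- **`∫ f(D t) dμ(t) = mod_F(det D)⁻¹ · ∫ f dμ`** for an additive Haar measure `μ` on `F^α` and `det D ≠ 0`. [cite: WeilBNT1967, Ch. I §2] -/
theorem integral_comp_mulVec_eq_smul (μ : Measure (α → F)) [μ.IsAddHaarMeasure] (D : Matrix α α F) (hD : D.det ≠ 0) (f : (α → F) → ℂ) :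
    ∫ t, f (D *ᵥ t) ∂μ = ((distribHaarChar F (Units.mk0 D.det hD))⁻¹ : ℝ≥0) • ∫ t, f t ∂μ := by
  obtain ⟨L, hL, hdet⟩ := exists_continuousLinearEquiv_apply_eq_mulVec D hD
  have h1 : ∫ t, f (D *ᵥ t) ∂μ = ∫ t, f t ∂(μ.map L.toContinuousAddEquiv) := by
    rw [show (⇑L.toContinuousAddEquiv : (α → F) → (α → F)) = ⇑(L.toHomeomorph.toMeasurableEquiv) from rfl, integral_map_equiv]
    exact integral_congr_ae (Filter.Eventually.of_forall fun t => by simp [hL])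
  rw [h1, map_eq_addEquivAddHaarChar_inv_smul μ L.toContinuousAddEquiv, integral_smul_nnreal_measure, addEquivAddHaarChar_continuousLinearEquiv L, hdet]

/-! ## §2 The Kudla–Rallis functional under Levi operators and trivial phases -/

variable {X : Type*} [AddCommGroup X] [TopologicalSpace X] {β γ : Type*}

/-- **`Λ(leviOp A Ψ) = mod_F(det D)⁻¹ · Λ(Ψ)`** when `A⁻¹` acts on the slice `u = 0` through `D` on the integrated block. [cite: KudlaRallis1994, §1] -/
theorem krFun_zero_leviOp (θ : X ≃ₜ ((β ⊕ γ) ⊕ α → F)) (μ : Measure (α → F)) [μ.IsAddHaarMeasure]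
    {R : Type*} [CommRing R] [Module R X] (A : X ≃ₗ[R] X) (D : Matrix α α F) (hD : D.det ≠ 0)
    (hS0 : ∀ t : α → F, θ (A.symm (θ.symm (Sum.elim (Sum.elim (0 : β → F) (0 : γ → F)) t))) = Sum.elim (Sum.elim (0 : β → F) (0 : γ → F)) (D *ᵥ t)) (Ψ : X → ℂ) :
    krFun θ μ (leviOp A Ψ) 0 = ((distribHaarChar F (Units.mk0 D.det hD))⁻¹ : ℝ≥0) • krFun θ μ Ψ 0 := by
  rw [krFun_apply, krFun_apply, ← integral_comp_mulVec_eq_smul μ D hD]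
  refine integral_congr_ae (Filter.Eventually.of_forall fun t => ?_)
  simp only [leviOp_apply]
  rw [← hS0 t, Homeomorph.symm_apply_apply]

omit [IsTopologicalRing F] [LocallyCompactSpace F] [SecondCountableTopology F] [BorelSpace F] [Fintype α] [DecidableEq α] [AddCommGroup X] in
/-- **`Λ(e·Ψ) = Λ(Ψ)`** when the phase `e` is `1` on the slice `u = 0`. [cite: KudlaRallis1994, §1] -/
theorem krFun_zero_of_phase_one (θ : X ≃ₜ ((β ⊕ γ) ⊕ α → F)) (μ : Measure (α → F)) (e : X → ℂ)
    (he : ∀ t : α → F, e (θ.symm (Sum.elim (Sum.elim (0 : β → F) (0 : γ → F)) t)) = 1) (Ψ : X → ℂ) :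
    krFun θ μ (fun x => e x * Ψ x) 0 = krFun θ μ Ψ 0 := by
  rw [krFun_apply, krFun_apply]
  refine integral_congr_ae (Filter.Eventually.of_forall fun t => ?_)
  simp only [he t, one_mul]

/-! ## §3 The functional under a Levi law -/

/-- **`Λ(ω(m a)Φ) = c_M(a) · mod_F(det D_a)⁻¹ · Λ(Φ)`** for a Levi law `ω(m a) Φ = c_M(a) • leviEquivSB (aX a) Φ` with slice matrices `D_a`.
[cite: KudlaRallis1994, §1] [cite: HarrisKudlaSweet1996, §4] -/
theorem krMap_zero_levi [T2Space F] (θ : X ≃ₜ ((β ⊕ γ) ⊕ α → F)) (μ : Measure (α → F)) [μ.IsAddHaarMeasure]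
    {R : Type*} [CommRing R] [Module R X]
    {H Γ₁ : Type*} (ω : H → SchwartzBruhat X →ₗ[ℂ] SchwartzBruhat X) (mΔ : Γ₁ → H) (aX : Γ₁ → (X ≃ₗ[R] X))
    (haXc : ∀ a, Continuous (aX a)) (haXc' : ∀ a, Continuous (aX a).symm) (cM : Γ₁ → ℂ)
    (hM : ∀ (a : Γ₁) (Φ : SchwartzBruhat X), ω (mΔ a) Φ = cM a • leviEquivSB (aX a) (haXc a) (haXc' a) Φ)
    (D : Γ₁ → Matrix α α F) (hD : ∀ a, (D a).det ≠ 0)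
    (hS0 : ∀ (a : Γ₁) (t : α → F), θ ((aX a).symm (θ.symm (Sum.elim (Sum.elim (0 : β → F) (0 : γ → F)) t))) = Sum.elim (Sum.elim (0 : β → F) (0 : γ → F)) (D a *ᵥ t))
    (a : Γ₁) (Φ : SchwartzBruhat X) :
    ((krMap θ μ (ω (mΔ a) Φ) : SchwartzBruhat (β → F)) : (β → F) → ℂ) 0 =
      cM a * (((distribHaarChar F (Units.mk0 (D a).det (hD a)))⁻¹ : ℝ≥0) • ((krMap θ μ Φ : SchwartzBruhat (β → F)) : (β → F) → ℂ) 0) := by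
  rw [hM, map_smul, Submodule.coe_smul, Pi.smul_apply, smul_eq_mul, coe_krMap_apply, coe_krMap_apply, coe_leviEquivSB,
    krFun_zero_leviOp θ μ (aX a) (D a) (hD a) (hS0 a)]

end Summit.HodgeConjecture.HodgeConjecture.Cruxes.HLiu418.K2LiuKRFunctionalLevi

end
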